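import Literature.NumberTheory.Weil1964.UnitaryArchSingularCentralizerFramePlaces        -- ★ p844365 U3: `conj_blockDiagFin_mem_archLocal`, `conj_blockDiagFin_mem_centralizer` (the local frame map)
import Literature.NumberTheory.Automorphic.UnitaryGroupBlockCentralizer                   -- ★ `mem_range_blockDiagFin_iff_commute`
import Literature.NumberTheory.Automorphic.UnitaryGroupSingularCentralizerDock            -- ★ `exists_continuousMulEquiv_coe_eq_of_injective` (open mapping theorem, explicit)
import Literature.NumberTheory.Automorphic.UnitaryGroupFormTransport                      -- ★ `unitaryGroupOfFormCongrOfEq`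
import Literature.NumberTheory.Automorphic.ArchLocalRegularOrbitClosed                    -- ★ `locallyCompactSpace_archLocal`, `secondCountableTopology_archLocal`
import HarnessLib

/-!
# THE LOCAL FRAME MAP IS AN ISOMORPHISM OF TOPOLOGICAL GROUPS `U(σ_w J₁)(ℂ) × U(σ_w J₂)(ℂ) ≃ₜ* Z(γ_w)`; the local frame measure of Haar blocks is Haar, of mass the
# product of the block masses («(U)-ROAD» brick U3-local-iso; Rogawski 1990 §3.8 Prop. 3.8.1 (a), §1.7)

Topic `NumberTheory/Weil1964`; namespace `Literature.NumberTheory.Weil1964.UnitaryArchTopForm` (home of ★ U3 `centralizerMeasureOfFrame_pi_eq_map_pi`).  THEOREMS ONLY (no `def`,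
no instance, no notation, no axiom, no named fact, no `sorry`).  Cell `pub/hodgecm-mathlib`, ENGINE T1 (crux H413 = `stmt-HodgeConjecture-24833`, supports-only); the (U) road
(LEAD F0P3a-plan (g10) T9-32 (4) ∕ T9-34 (2); MEMO «(U)-ROAD v0» F0P3-p03 (g11) 0f8ca2f389d5ab6c; U5 generic assembly p844463 `exists_universalPinRatio_of_localData`, whose
hypothesis (HC) «the local frame measure `θ_w` is Haar of mass `M`» this file reduces to «the BLOCK measures are Haar with masses multiplying to `M`»).  Count-neutral;
HONEST LABEL: HC_CM is proved only modulo the printed citations until rung 0 closes; pays nothing by itself.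

WHAT.  At a complex place `w`, with a local frame `T_w` (`T_wᴴ σ_w(J) T_w = σ_w(J₁ ⊕ᶠ J₂)`) of `γ_w ∈ U(σ_w J)(ℂ)` (`γ_w T_w = T_w (a·1 ⊕ᶠ b·1)`, `a ≠ b`), ★ U3's local
frame map `λ_w : u ↦ T_w (u₁ ⊕ᶠ u₂) T_w⁻¹ : U(σ_w J₁)(ℂ) × U(σ_w J₂)(ℂ) → Z(γ_w)` is: §1 injective, continuous and SURJECTIVE (a unit commuting with the block scalar
`a·1 ⊕ᶠ b·1`, `a − b` a unit, is block diagonal: ★ `mem_range_blockDiagFin_iff_commute`, transported by the congruence ★ `unitaryGroupOfFormCongrOfEq T_w`) — the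
computation of ★ `range_archFrameEmbedding_eq_centralizer`, verbatim over `ℂ`; §2 hence an isomorphism of topological groups onto `Z(γ_w)` (open mapping theorem, ★
`exists_continuousMulEquiv_coe_eq_of_injective`); §3 so the local frame measure `θ_w = λ_w⁎(μ₁ ⊗ μ₂)` of Haar block measures is a Haar measure on `Z(γ_w)`
(Mathlib `ContinuousMulEquiv.isHaarMeasure_map`), and — for any block measures — `θ_w(Z(γ_w)) = μ₁(U(σ_w J₁)) · μ₂(U(σ_w J₂))`.

## References
* [Rogawski1990] J. D. Rogawski, *Automorphic Representations of Unitary Groups in Three Variables*, Ann. of Math. Stud. 123 (1990), §1.7 p. 6; §3.8 Prop. 3.8.1 (a) p. 27.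
* [HewittRoss1979] E. Hewitt, K. A. Ross, *Abstract Harmonic Analysis I*, 2nd ed. (1979), Thm. (5.29) (open mapping theorem for σ-compact locally compact groups).
* [DeitmarEchterhoff2014] A. Deitmar, S. Echterhoff, *Principles of Harmonic Analysis*, 2nd ed. (2014), Thm. 1.5.3 (product of Haar measures).
-/

set_option autoImplicit false

noncomputable section

open NumberField NumberField.InfinitePlace Set MeasureTheory MeasureTheory.Measure
open Literature.NumberTheory.Automorphic Literature.NumberTheory.Automorphic.UnitaryGroup
open scoped Matrix MatrixGroups ENNReal

namespace Literature.NumberTheory.Weil1964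

namespace UnitaryArchTopForm

variable (L : Type) [Field L] [NumberField L] [IsCMField L]

section LocalFrame

variable {N₁ N₂ : ℕ} {J : Matrix (Fin (N₁ + N₂)) (Fin (N₁ + N₂)) L} {J₁ : Matrix (Fin N₁) (Fin N₁) L} {J₂ : Matrix (Fin N₂) (Fin N₂) L}
  (w : {w : InfinitePlace L // IsComplex w}) {Tw : GL (Fin (N₁ + N₂)) ℂ}
  (hTw : formCongr (starRingEnd ℂ) Tw (J.map w.1.embedding) = (finSum N₁ N₂ J₁ J₂).map w.1.embedding)
  (γw : archLocal L (N₁ + N₂) J w) {a b : ℂ}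
  (hγw : ((γw : GL (Fin (N₁ + N₂)) ℂ) : Matrix (Fin (N₁ + N₂)) (Fin (N₁ + N₂)) ℂ) * (Tw : Matrix (Fin (N₁ + N₂)) (Fin (N₁ + N₂)) ℂ) =
    (Tw : Matrix (Fin (N₁ + N₂)) (Fin (N₁ + N₂)) ℂ) * finSum N₁ N₂ (a • (1 : Matrix (Fin N₁) (Fin N₁) ℂ)) (b • 1))

/-! ## §1 The local frame map is injective, continuous, multiplicative and — for `a ≠ b` — onto `Z(γ_w)` -/

omit [NumberField L] [IsCMField L] in
/-- The local frame map `u ↦ T_w (u₁ ⊕ᶠ u₂) T_w⁻¹` is injective (★ `blockDiagFin_injective`, conjugation is injective). [cite: Rogawski1990, §3.8 Prop. 3.8.1 (a) p. 27] -/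
theorem injective_localFrame :
    Function.Injective (fun u : archLocal L N₁ J₁ w × archLocal L N₂ J₂ w =>
      (⟨⟨Tw * ((blockDiagFin (starRingEnd ℂ) (J₁.map w.1.embedding) (J₂.map w.1.embedding) u : unitaryGroupOfForm (starRingEnd ℂ) (finSum N₁ N₂ (J₁.map w.1.embedding) (J₂.map w.1.embedding))) :
          GL (Fin (N₁ + N₂)) ℂ) * Tw⁻¹, conj_blockDiagFin_mem_archLocal L w hTw u⟩, conj_blockDiagFin_mem_centralizer L w hTw γw hγw u⟩ :
        Subgroup.centralizer ({γw} : Set (archLocal L (N₁ + N₂) J w)))) := by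
  intro u v huv
  have h : Tw * ((blockDiagFin (starRingEnd ℂ) (J₁.map w.1.embedding) (J₂.map w.1.embedding) u : unitaryGroupOfForm (starRingEnd ℂ) (finSum N₁ N₂ (J₁.map w.1.embedding) (J₂.map w.1.embedding))) :
        GL (Fin (N₁ + N₂)) ℂ) * Tw⁻¹ =
      Tw * ((blockDiagFin (starRingEnd ℂ) (J₁.map w.1.embedding) (J₂.map w.1.embedding) v : unitaryGroupOfForm (starRingEnd ℂ) (finSum N₁ N₂ (J₁.map w.1.embedding) (J₂.map w.1.embedding))) :
        GL (Fin (N₁ + N₂)) ℂ) * Tw⁻¹ :=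
    congrArg (fun k : Subgroup.centralizer ({γw} : Set (archLocal L (N₁ + N₂) J w)) => ((k : archLocal L (N₁ + N₂) J w) : GL (Fin (N₁ + N₂)) ℂ)) huv
  have h' := mul_left_cancel (mul_right_cancel h)
  exact blockDiagFin_injective (starRingEnd ℂ) _ _ (Subtype.ext h')

omit [NumberField L] [IsCMField L] in
/-- The local frame map is continuous. [cite: Rogawski1990, §3.8 Prop. 3.8.1 (a) p. 27] -/
theorem continuous_localFrame :
    Continuous (fun u : archLocal L N₁ J₁ w × archLocal L N₂ J₂ w =>
      (⟨⟨Tw * ((blockDiagFin (starRingEnd ℂ) (J₁.map w.1.embedding) (J₂.map w.1.embedding) u : unitaryGroupOfForm (starRingEnd ℂ) (finSum N₁ N₂ (J₁.map w.1.embedding) (J₂.map w.1.embedding))) :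
          GL (Fin (N₁ + N₂)) ℂ) * Tw⁻¹, conj_blockDiagFin_mem_archLocal L w hTw u⟩, conj_blockDiagFin_mem_centralizer L w hTw γw hγw u⟩ :
        Subgroup.centralizer ({γw} : Set (archLocal L (N₁ + N₂) J w)))) :=
  ((continuous_const.mul (continuous_subtype_val.comp (continuous_blockDiagFin (starRingEnd ℂ) _ _))).mul continuous_const).subtype_mk _ |>.subtype_mk _

omit [NumberField L] [IsCMField L] in
/-- The local frame map is multiplicative. [cite: Rogawski1990, §3.8 Prop. 3.8.1 (a) p. 27] -/
theorem localFrame_mul (u v : archLocal L N₁ J₁ w × archLocal L N₂ J₂ w) :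
    (fun u : archLocal L N₁ J₁ w × archLocal L N₂ J₂ w =>
      (⟨⟨Tw * ((blockDiagFin (starRingEnd ℂ) (J₁.map w.1.embedding) (J₂.map w.1.embedding) u : unitaryGroupOfForm (starRingEnd ℂ) (finSum N₁ N₂ (J₁.map w.1.embedding) (J₂.map w.1.embedding))) :
          GL (Fin (N₁ + N₂)) ℂ) * Tw⁻¹, conj_blockDiagFin_mem_archLocal L w hTw u⟩, conj_blockDiagFin_mem_centralizer L w hTw γw hγw u⟩ :
        Subgroup.centralizer ({γw} : Set (archLocal L (N₁ + N₂) J w)))) (u * v) =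
    (fun u : archLocal L N₁ J₁ w × archLocal L N₂ J₂ w =>
      (⟨⟨Tw * ((blockDiagFin (starRingEnd ℂ) (J₁.map w.1.embedding) (J₂.map w.1.embedding) u : unitaryGroupOfForm (starRingEnd ℂ) (finSum N₁ N₂ (J₁.map w.1.embedding) (J₂.map w.1.embedding))) :
          GL (Fin (N₁ + N₂)) ℂ) * Tw⁻¹, conj_blockDiagFin_mem_archLocal L w hTw u⟩, conj_blockDiagFin_mem_centralizer L w hTw γw hγw u⟩ :
        Subgroup.centralizer ({γw} : Set (archLocal L (N₁ + N₂) J w)))) u *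
    (fun u : archLocal L N₁ J₁ w × archLocal L N₂ J₂ w =>
      (⟨⟨Tw * ((blockDiagFin (starRingEnd ℂ) (J₁.map w.1.embedding) (J₂.map w.1.embedding) u : unitaryGroupOfForm (starRingEnd ℂ) (finSum N₁ N₂ (J₁.map w.1.embedding) (J₂.map w.1.embedding))) :
          GL (Fin (N₁ + N₂)) ℂ) * Tw⁻¹, conj_blockDiagFin_mem_archLocal L w hTw u⟩, conj_blockDiagFin_mem_centralizer L w hTw γw hγw u⟩ :
        Subgroup.centralizer ({γw} : Set (archLocal L (N₁ + N₂) J w)))) v := by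
  apply Subtype.ext
  apply Subtype.ext
  have hm : ((blockDiagFin (starRingEnd ℂ) (J₁.map w.1.embedding) (J₂.map w.1.embedding) (u * v : archLocal L N₁ J₁ w × archLocal L N₂ J₂ w) :
        unitaryGroupOfForm (starRingEnd ℂ) (finSum N₁ N₂ (J₁.map w.1.embedding) (J₂.map w.1.embedding))) : GL (Fin (N₁ + N₂)) ℂ) =
      ((blockDiagFin (starRingEnd ℂ) (J₁.map w.1.embedding) (J₂.map w.1.embedding) u : unitaryGroupOfForm (starRingEnd ℂ) (finSum N₁ N₂ (J₁.map w.1.embedding) (J₂.map w.1.embedding))) : GL (Fin (N₁ + N₂)) ℂ) *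
      ((blockDiagFin (starRingEnd ℂ) (J₁.map w.1.embedding) (J₂.map w.1.embedding) v : unitaryGroupOfForm (starRingEnd ℂ) (finSum N₁ N₂ (J₁.map w.1.embedding) (J₂.map w.1.embedding))) : GL (Fin (N₁ + N₂)) ℂ) := by
    exact congrArg Subtype.val (map_mul (blockDiagFin (starRingEnd ℂ) (J₁.map w.1.embedding) (J₂.map w.1.embedding)) u v)
  -- `T (B₁ B₂) T⁻¹ = (T B₁ T⁻¹) (T B₂ T⁻¹)`
  refine (congrArg (fun x : GL (Fin (N₁ + N₂)) ℂ => Tw * x * Tw⁻¹) hm).trans ?_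
  simp only [Subgroup.coe_mul]
  group

omit [NumberField L] [IsCMField L] in
include hTw hγw in
/-- **THE LOCAL FRAME MAP IS ONTO `Z(γ_w)`** when `a ≠ b`: an element of `U(σ_w J)(ℂ)` commuting with `γ_w = T_w (a·1 ⊕ᶠ b·1) T_w⁻¹` is `T_w (u₁ ⊕ᶠ u₂) T_w⁻¹` with
`u_i ∈ U(σ_w J_i)(ℂ)` (★ `mem_range_blockDiagFin_iff_commute` for `T_w⁻¹ k T_w ∈ U(σ_w(J₁ ⊕ᶠ J₂))`, ★ `unitaryGroupOfFormCongrOfEq`) — the computation of ★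
`range_archFrameEmbedding_eq_centralizer` over `ℂ`. [cite: Rogawski1990, §3.8 Prop. 3.8.1 (a) p. 27] -/
theorem surjective_localFrame (hab : a ≠ b) :
    Function.Surjective (fun u : archLocal L N₁ J₁ w × archLocal L N₂ J₂ w =>
      (⟨⟨Tw * ((blockDiagFin (starRingEnd ℂ) (J₁.map w.1.embedding) (J₂.map w.1.embedding) u : unitaryGroupOfForm (starRingEnd ℂ) (finSum N₁ N₂ (J₁.map w.1.embedding) (J₂.map w.1.embedding))) :
          GL (Fin (N₁ + N₂)) ℂ) * Tw⁻¹, conj_blockDiagFin_mem_archLocal L w hTw u⟩, conj_blockDiagFin_mem_centralizer L w hTw γw hγw u⟩ :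
        Subgroup.centralizer ({γw} : Set (archLocal L (N₁ + N₂) J w)))) := by
  intro k
  have hTw' : formCongr (starRingEnd ℂ) Tw (J.map w.1.embedding) = finSum N₁ N₂ (J₁.map w.1.embedding) (J₂.map w.1.embedding) := by rw [hTw, finSum_map]
  -- `g := T_w⁻¹ k T_w ∈ U(σ_w J₁ ⊕ᶠ σ_w J₂)`
  set Φ := unitaryGroupOfFormCongrOfEq (starRingEnd ℂ) Tw (J.map w.1.embedding) (finSum N₁ N₂ (J₁.map w.1.embedding) (J₂.map w.1.embedding)) hTw' with hΦ
  set g : unitaryGroupOfForm (starRingEnd ℂ) (finSum N₁ N₂ (J₁.map w.1.embedding) (J₂.map w.1.embedding)) :=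
    Φ.symm ⟨((k : archLocal L (N₁ + N₂) J w) : GL (Fin (N₁ + N₂)) ℂ), (k : archLocal L (N₁ + N₂) J w).2⟩ with hg
  have hgv : ((g : unitaryGroupOfForm (starRingEnd ℂ) (finSum N₁ N₂ (J₁.map w.1.embedding) (J₂.map w.1.embedding))) : GL (Fin (N₁ + N₂)) ℂ) =
      Tw⁻¹ * ((k : archLocal L (N₁ + N₂) J w) : GL (Fin (N₁ + N₂)) ℂ) * Tw := rfl
  -- `g` commutes with the block scalar
  set Tm : Matrix (Fin (N₁ + N₂)) (Fin (N₁ + N₂)) ℂ := (Tw : Matrix (Fin (N₁ + N₂)) (Fin (N₁ + N₂)) ℂ) with hTm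
  set Ti : Matrix (Fin (N₁ + N₂)) (Fin (N₁ + N₂)) ℂ := ((Tw⁻¹ : GL (Fin (N₁ + N₂)) ℂ) : Matrix (Fin (N₁ + N₂)) (Fin (N₁ + N₂)) ℂ) with hTi
  have hTT : Tm * Ti = 1 := by rw [hTm, hTi, ← Units.val_mul, mul_inv_cancel, Units.val_one]
  have hTT' : Ti * Tm = 1 := by rw [hTm, hTi, ← Units.val_mul, inv_mul_cancel, Units.val_one]
  set D := finSum N₁ N₂ (a • (1 : Matrix (Fin N₁) (Fin N₁) ℂ)) (b • 1) with hD
  set Km : Matrix (Fin (N₁ + N₂)) (Fin (N₁ + N₂)) ℂ := (((k : archLocal L (N₁ + N₂) J w) : GL (Fin (N₁ + N₂)) ℂ) : Matrix (Fin (N₁ + N₂)) (Fin (N₁ + N₂)) ℂ) with hKm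
  have hγ' : ((γw : GL (Fin (N₁ + N₂)) ℂ) : Matrix (Fin (N₁ + N₂)) (Fin (N₁ + N₂)) ℂ) = Tm * D * Ti := by
    rw [← hγw, Matrix.mul_assoc, hTT, Matrix.mul_one]
  have hkγ : Km * (Tm * D * Ti) = (Tm * D * Ti) * Km := by
    have hk := k.2
    rw [Subgroup.mem_centralizer_iff] at hk
    have hk' := hk γw (Set.mem_singleton _)
    have hk'' := congrArg (fun x : archLocal L (N₁ + N₂) J w => ((x : GL (Fin (N₁ + N₂)) ℂ) : Matrix (Fin (N₁ + N₂)) (Fin (N₁ + N₂)) ℂ)) hk'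
    simp only [Subgroup.coe_mul, Units.val_mul] at hk''
    rw [hγ'] at hk''
    exact hk''.symm
  have hcomm : (((g : unitaryGroupOfForm (starRingEnd ℂ) (finSum N₁ N₂ (J₁.map w.1.embedding) (J₂.map w.1.embedding))) : GL (Fin (N₁ + N₂)) ℂ) :
        Matrix (Fin (N₁ + N₂)) (Fin (N₁ + N₂)) ℂ) * D = D * (((g : unitaryGroupOfForm (starRingEnd ℂ) (finSum N₁ N₂ (J₁.map w.1.embedding) (J₂.map w.1.embedding))) : GL (Fin (N₁ + N₂)) ℂ) : Matrix (Fin (N₁ + N₂)) (Fin (N₁ + N₂)) ℂ) := by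
    rw [hgv, Units.val_mul, Units.val_mul]
    change Ti * Km * Tm * D = D * (Ti * Km * Tm)
    calc Ti * Km * Tm * D = Ti * Km * (Tm * D * Ti) * Tm := by simp only [Matrix.mul_assoc]; rw [hTT', Matrix.mul_one]
      _ = Ti * (Km * (Tm * D * Ti)) * Tm := by simp only [Matrix.mul_assoc]
      _ = Ti * (Tm * D * Ti * Km) * Tm := by rw [hkγ]
      _ = (Ti * Tm) * D * (Ti * Km * Tm) := by simp only [Matrix.mul_assoc]
      _ = D * (Ti * Km * Tm) := by rw [hTT', Matrix.one_mul]
  -- hence block diagonal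
  obtain ⟨u, hu⟩ := (mem_range_blockDiagFin_iff_commute (starRingEnd ℂ) (J₁.map w.1.embedding) (J₂.map w.1.embedding) (sub_ne_zero.2 hab).isUnit g).2 hcomm
  refine ⟨u, ?_⟩
  apply Subtype.ext
  apply Subtype.ext
  change Tw * ((blockDiagFin (starRingEnd ℂ) (J₁.map w.1.embedding) (J₂.map w.1.embedding) u : unitaryGroupOfForm (starRingEnd ℂ) (finSum N₁ N₂ (J₁.map w.1.embedding) (J₂.map w.1.embedding))) :
      GL (Fin (N₁ + N₂)) ℂ) * Tw⁻¹ = ((k : archLocal L (N₁ + N₂) J w) : GL (Fin (N₁ + N₂)) ℂ)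
  rw [hu, hgv, ← mul_assoc, ← mul_assoc, mul_inv_cancel, one_mul, mul_assoc, mul_inv_cancel, mul_one]

/-! ## §2 `U(σ_w J₁)(ℂ) × U(σ_w J₂)(ℂ) ≃ₜ* Z(γ_w)` with the formula -/

omit [NumberField L] [IsCMField L] in
include hTw hγw in
/-- **THE LOCAL FRAME ISOMORPHISM**: for `a ≠ b` there is an isomorphism of topological groups `e : U(σ_w J₁)(ℂ) × U(σ_w J₂)(ℂ) ≃ₜ* Z(γ_w)` which IS the local frame map
(continuous bijective homomorphism between σ-compact locally compact groups — the open mapping theorem, ★ `exists_continuousMulEquiv_coe_eq_of_injective`).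
[cite: Rogawski1990, §3.8 Prop. 3.8.1 (a) p. 27] [cite: HewittRoss1979, Thm. (5.29)] -/
theorem exists_continuousMulEquiv_localFrame (hab : a ≠ b) :
    ∃ e : (archLocal L N₁ J₁ w × archLocal L N₂ J₂ w) ≃ₜ* Subgroup.centralizer ({γw} : Set (archLocal L (N₁ + N₂) J w)),
      ⇑e = (fun u : archLocal L N₁ J₁ w × archLocal L N₂ J₂ w =>
        (⟨⟨Tw * ((blockDiagFin (starRingEnd ℂ) (J₁.map w.1.embedding) (J₂.map w.1.embedding) u : unitaryGroupOfForm (starRingEnd ℂ) (finSum N₁ N₂ (J₁.map w.1.embedding) (J₂.map w.1.embedding))) :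
            GL (Fin (N₁ + N₂)) ℂ) * Tw⁻¹, conj_blockDiagFin_mem_archLocal L w hTw u⟩, conj_blockDiagFin_mem_centralizer L w hTw γw hγw u⟩ :
          Subgroup.centralizer ({γw} : Set (archLocal L (N₁ + N₂) J w)))) := by
  haveI : LocallyCompactSpace (archLocal L N₁ J₁ w) := locallyCompactSpace_archLocal L N₁ J₁ w
  haveI : LocallyCompactSpace (archLocal L N₂ J₂ w) := locallyCompactSpace_archLocal L N₂ J₂ w
  haveI : LocallyCompactSpace (archLocal L (N₁ + N₂) J w) := locallyCompactSpace_archLocal L (N₁ + N₂) J w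
  haveI : SecondCountableTopology (archLocal L N₁ J₁ w) := secondCountableTopology_archLocal L N₁ J₁ w
  haveI : SecondCountableTopology (archLocal L N₂ J₂ w) := secondCountableTopology_archLocal L N₂ J₂ w
  -- the local frame map as a homomorphism into `U(σ_w J)(ℂ)`
  let f : archLocal L N₁ J₁ w × archLocal L N₂ J₂ w →* archLocal L (N₁ + N₂) J w :=
    { toFun := fun u => ⟨Tw * ((blockDiagFin (starRingEnd ℂ) (J₁.map w.1.embedding) (J₂.map w.1.embedding) u : unitaryGroupOfForm (starRingEnd ℂ) (finSum N₁ N₂ (J₁.map w.1.embedding) (J₂.map w.1.embedding))) :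
          GL (Fin (N₁ + N₂)) ℂ) * Tw⁻¹, conj_blockDiagFin_mem_archLocal L w hTw u⟩
      map_one' := by
        apply Subtype.ext
        have h1 : ((blockDiagFin (starRingEnd ℂ) (J₁.map w.1.embedding) (J₂.map w.1.embedding) (1 : archLocal L N₁ J₁ w × archLocal L N₂ J₂ w) :
            unitaryGroupOfForm (starRingEnd ℂ) (finSum N₁ N₂ (J₁.map w.1.embedding) (J₂.map w.1.embedding))) : GL (Fin (N₁ + N₂)) ℂ) = 1 := by
          exact congrArg Subtype.val (map_one (blockDiagFin (starRingEnd ℂ) (J₁.map w.1.embedding) (J₂.map w.1.embedding)))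
        change Tw * ((blockDiagFin (starRingEnd ℂ) (J₁.map w.1.embedding) (J₂.map w.1.embedding) (1 : archLocal L N₁ J₁ w × archLocal L N₂ J₂ w) :
            unitaryGroupOfForm (starRingEnd ℂ) (finSum N₁ N₂ (J₁.map w.1.embedding) (J₂.map w.1.embedding))) : GL (Fin (N₁ + N₂)) ℂ) * Tw⁻¹ = 1
        rw [h1, mul_one, mul_inv_cancel]
      map_mul' := fun u v => congrArg (fun k : Subgroup.centralizer ({γw} : Set (archLocal L (N₁ + N₂) J w)) => (k : archLocal L (N₁ + N₂) J w))
        (localFrame_mul L w hTw γw hγw u v) }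
  have hf : ∀ u, f u = ⟨Tw * ((blockDiagFin (starRingEnd ℂ) (J₁.map w.1.embedding) (J₂.map w.1.embedding) u : unitaryGroupOfForm (starRingEnd ℂ) (finSum N₁ N₂ (J₁.map w.1.embedding) (J₂.map w.1.embedding))) :
      GL (Fin (N₁ + N₂)) ℂ) * Tw⁻¹, conj_blockDiagFin_mem_archLocal L w hTw u⟩ := fun _ => rfl
  have hinj : Function.Injective f := fun u v huv =>
    injective_localFrame L w hTw γw hγw (Subtype.ext (Subtype.ext (congrArg (fun k : archLocal L (N₁ + N₂) J w => (k : GL (Fin (N₁ + N₂)) ℂ)) huv)))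
  have hcont : Continuous f :=
    ((continuous_const.mul (continuous_subtype_val.comp (continuous_blockDiagFin (starRingEnd ℂ) _ _))).mul continuous_const).subtype_mk _
  have hrange : f.range = Subgroup.centralizer ({γw} : Set (archLocal L (N₁ + N₂) J w)) := by
    ext k
    constructor
    · rintro ⟨u, rfl⟩
      exact conj_blockDiagFin_mem_centralizer L w hTw γw hγw u
    · intro hk
      obtain ⟨u, hu⟩ := surjective_localFrame L w hTw γw hγw hab ⟨k, hk⟩
      exact ⟨u, congrArg Subtype.val hu⟩
  obtain ⟨e, he⟩ := exists_continuousMulEquiv_coe_eq_of_injective f hinj hcont _ hrange (isClosed_coe_centralizer_singleton _)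
  exact ⟨e, funext fun u => Subtype.ext (he u)⟩

/-! ## §3 The local frame measure: Haar for Haar blocks; total mass = product of the block masses -/

omit [NumberField L] [IsCMField L] in
include hTw hγw in
/-- **THE LOCAL FRAME MEASURE OF HAAR BLOCKS IS HAAR**: `θ_w := λ_w⁎(μ₁ ⊗ μ₂)` is a Haar measure on `Z(γ_w)` for Haar `μ₁, μ₂` and `a ≠ b` (§2 + Mathlib
`ContinuousMulEquiv.isHaarMeasure_map`). [cite: Rogawski1990, §1.7 p. 6; §3.8 Prop. 3.8.1 (a) p. 27] [cite: DeitmarEchterhoff2014, Thm. 1.5.3] -/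
theorem isHaarMeasure_map_localFrame (hab : a ≠ b) [MeasurableSpace (GL (Fin (N₁ + N₂)) ℂ)] [BorelSpace (GL (Fin (N₁ + N₂)) ℂ)]
    [MeasurableSpace (GL (Fin N₁) ℂ)] [BorelSpace (GL (Fin N₁) ℂ)] [MeasurableSpace (GL (Fin N₂) ℂ)] [BorelSpace (GL (Fin N₂) ℂ)]
    (μ₁ : Measure (archLocal L N₁ J₁ w)) (μ₂ : Measure (archLocal L N₂ J₂ w)) [μ₁.IsHaarMeasure] [μ₂.IsHaarMeasure] :
    ((μ₁.prod μ₂).map (fun u : archLocal L N₁ J₁ w × archLocal L N₂ J₂ w =>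
        (⟨⟨Tw * ((blockDiagFin (starRingEnd ℂ) (J₁.map w.1.embedding) (J₂.map w.1.embedding) u : unitaryGroupOfForm (starRingEnd ℂ) (finSum N₁ N₂ (J₁.map w.1.embedding) (J₂.map w.1.embedding))) :
            GL (Fin (N₁ + N₂)) ℂ) * Tw⁻¹, conj_blockDiagFin_mem_archLocal L w hTw u⟩, conj_blockDiagFin_mem_centralizer L w hTw γw hγw u⟩ :
          Subgroup.centralizer ({γw} : Set (archLocal L (N₁ + N₂) J w))))).IsHaarMeasure := by
  haveI : SecondCountableTopology (archLocal L N₁ J₁ w) := secondCountableTopology_archLocal L N₁ J₁ w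
  haveI : SecondCountableTopology (archLocal L N₂ J₂ w) := secondCountableTopology_archLocal L N₂ J₂ w
  haveI : LocallyCompactSpace (archLocal L N₁ J₁ w) := locallyCompactSpace_archLocal L N₁ J₁ w
  haveI : LocallyCompactSpace (archLocal L N₂ J₂ w) := locallyCompactSpace_archLocal L N₂ J₂ w
  haveI : BorelSpace (archLocal L N₁ J₁ w × archLocal L N₂ J₂ w) := Prod.borelSpace
  haveI : SigmaFinite μ₁ := inferInstance
  haveI : SigmaFinite μ₂ := inferInstance
  haveI : (μ₁.prod μ₂).IsHaarMeasure := inferInstance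
  obtain ⟨e, he⟩ := exists_continuousMulEquiv_localFrame L w hTw γw hγw hab
  rw [← he]
  exact e.isHaarMeasure_map _

omit [NumberField L] [IsCMField L] in
include hTw hγw in
/-- **THE MASS OF THE LOCAL FRAME MEASURE** is the product of the block masses: `θ_w(Z(γ_w)) = μ₁(U(σ_w J₁)(ℂ)) · μ₂(U(σ_w J₂)(ℂ))` (for s-finite blocks).
[cite: Rogawski1990, §1.7 p. 6] [cite: DeitmarEchterhoff2014, Thm. 1.5.3] -/
theorem map_localFrame_apply_univ [MeasurableSpace (GL (Fin (N₁ + N₂)) ℂ)] [BorelSpace (GL (Fin (N₁ + N₂)) ℂ)]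
    [MeasurableSpace (GL (Fin N₁) ℂ)] [BorelSpace (GL (Fin N₁) ℂ)] [MeasurableSpace (GL (Fin N₂) ℂ)] [BorelSpace (GL (Fin N₂) ℂ)]
    (μ₁ : Measure (archLocal L N₁ J₁ w)) (μ₂ : Measure (archLocal L N₂ J₂ w)) [SFinite μ₁] [SFinite μ₂] :
    (μ₁.prod μ₂).map (fun u : archLocal L N₁ J₁ w × archLocal L N₂ J₂ w =>
        (⟨⟨Tw * ((blockDiagFin (starRingEnd ℂ) (J₁.map w.1.embedding) (J₂.map w.1.embedding) u : unitaryGroupOfForm (starRingEnd ℂ) (finSum N₁ N₂ (J₁.map w.1.embedding) (J₂.map w.1.embedding))) :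
            GL (Fin (N₁ + N₂)) ℂ) * Tw⁻¹, conj_blockDiagFin_mem_archLocal L w hTw u⟩, conj_blockDiagFin_mem_centralizer L w hTw γw hγw u⟩ :
          Subgroup.centralizer ({γw} : Set (archLocal L (N₁ + N₂) J w)))) Set.univ = μ₁ Set.univ * μ₂ Set.univ := by
  haveI : SecondCountableTopology (archLocal L N₁ J₁ w) := secondCountableTopology_archLocal L N₁ J₁ w
  haveI : SecondCountableTopology (archLocal L N₂ J₂ w) := secondCountableTopology_archLocal L N₂ J₂ w
  haveI : BorelSpace (archLocal L N₁ J₁ w × archLocal L N₂ J₂ w) := Prod.borelSpace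
  rw [Measure.map_apply (continuous_localFrame L w hTw γw hγw).measurable MeasurableSet.univ, Set.preimage_univ, ← Set.univ_prod_univ, Measure.prod_prod]

end LocalFrame

end UnitaryArchTopForm

end Literature.NumberTheory.Weil1964

end
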